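import Literature.AlgebraicGeometry.Frobenioids.Thm49Padic
import Literature.AlgebraicGeometry.Frobenioids.PadicFrobenioidRelCosetBase
import HarnessLib

/-!
# Frobenioids I, Theorem 4.9 at the `p`-adic Frobenioids over the tempered bases `D = 𝓑^temp(Π, Π°)⁰` of
# [FrdII] Example 1.3 — hypothesis-free (the local Frobenioids of [EtTh] / [IUTchI] live over such bases)

Mochizuki, *The geometry of Frobenioids I*, Kyushu J. Math. **62** (2008), Theorem 4.9 p. 88
[cite: MochizukiFrdI2008, Thm. 4.9 p.88]; *The geometry of Frobenioids II*, Kyushu J. Math. **62** (2008), Example 1.3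
(iii) pp. 11–12: "when `F = ℚ_p`, if we set `D := 𝓑^temp(Π, Π°)⁰`, then we obtain a functor `D → D₀` … which satisfies
the hypotheses of Theorem 1.2, (i). That is to say, in this case, the main results of the theory of [Mzk5] may be
applied to the `p`-adic Frobenioids of Example 1.1, (ii)" [cite: MochizukiFrdII2008, Ex 1.3 (iii) pp.11-12].

PROOF-ONLY file (node FrdI:Thm4.9 / FrdII:Ex1.3(iii); seat abc-iut-w4-d109; sequel of `Thm49Padic.lean`), 0 definitions.
`Thm49Padic.lean` proves [FrdI] Thm. 4.9 (with its compatibility clause) for `p`-adic Frobenioid data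
`d : PadicFrd.Datum D p` over bases of FSM-type. For a topological group `Π` with an open subgroup `Π°` the small
model `RelCosetCat Π°` of `𝓑^temp(Π, Π°)⁰` IS of FSM-type (seat abc-iut-L1-t4's `RelCosetCat.isOfFSMType`, Ex. 1.3 (i)
"of FSM-type"), so every hypothesis is discharged: for `p`-adic Frobenioid data `d_i : PadicFrd.Datum (RelCosetCat Π°_i)
p_i` (arbitrary primes, groups, data) and EVERY equivalence `Ψ : C₁ ⥲ C₂`, the typed `Thm49` (any parameters), its
conclusion `Ψ^Φ : Φ₁ ⥲ Φ₂` over `Ψ`, and the typed `Thm49_compat` hold with NO hypothesis. This is "the main results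
of [FrdI] may be applied" made literal for Thm. 4.9. (Cor. 4.11 needs in addition a SLIM base — `Cor411Padic.lean`
— i.e. `Π` slim; not claimed here.) No statement of either paper is restated or strengthened; nothing here bears
on, or takes a side on, [IUTchIII] Cor. 3.12.
-/

noncomputable section

namespace Literature.AlgebraicGeometry.Frobenioids

open CategoryTheory Opposite
open PreFrobenioid PreFrobenioidData Literature.AnabelianGeometry.SemiGraphs

namespace PadicFrd

section Tempered

variable {P₁ : Type} [Group P₁] [TopologicalSpace P₁] [IsTopologicalGroup P₁] (P₀₁ : OpenSubgroup P₁)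
variable {P₂ : Type} [Group P₂] [TopologicalSpace P₂] [IsTopologicalGroup P₂] (P₀₂ : OpenSubgroup P₂)
variable {p₁ p₂ : ℕ} [Fact p₁.Prime] [Fact p₂.Prime]
variable (d₁ : Datum (RelCosetCat P₀₁) p₁) (d₂ : Datum (RelCosetCat P₀₂) p₂)

/-- **[FrdI] Thm. 4.9 AS TYPED for `p`-adic Frobenioids over tempered bases `𝓑^temp(Π_i, Π°_i)⁰`, any equivalence
`Ψ`, ANY Def. 4.5 (iii) parameters — no hypothesis** (the bases are of FSM-type, [FrdII] Ex. 1.3 (i)/(iii)).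
[cite: MochizukiFrdI2008, Thm. 4.9 p.88] [cite: MochizukiFrdII2008, Ex 1.3 (iii) pp.11-12] -/
theorem thm49_padic_relCoset (Ψ : d₁.frobenioid ≌ d₂.frobenioid)
    (R₁ : (ModelFrobenioid.data d₁.Φ d₁.B d₁.divB).RSParams)
    (R₂ : (ModelFrobenioid.data d₂.Φ d₂.B d₂.divB).RSParams) :
    (ModelFrobenioid.data d₁.Φ d₁.B d₁.divB).Thm49 (ModelFrobenioid.data d₂.Φ d₂.B d₂.divB) Ψ R₁ R₂ :=
  thm49_padic_rsParams d₁ d₂ (RelCosetCat.isOfFSMType P₀₁) (RelCosetCat.isOfFSMType P₀₂) Ψ R₁ R₂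

/-- **The conclusion of [FrdI] Thm. 4.9 for `p`-adic Frobenioids over tempered bases, no hypothesis**: for every
equivalence `Ψ : C₁ ⥲ C₂` there is an isomorphism of functors `Ψ^Φ : Φ₁ ⥲ Φ₂` lying over `Ψ` (the antecedents
"rationally standard type" being [FrdII] Thm. 1.2 (i) at THE parameters over the FSM-type base `𝓑^temp(Π, Π°)⁰`).
[cite: MochizukiFrdI2008, Thm. 4.9 p.88] [cite: MochizukiFrdII2008, Ex 1.3 (iii) pp.11-12] -/
theorem nonempty_divisorMonoidIsoOver_padic_relCoset (Ψ : d₁.frobenioid ≌ d₂.frobenioid) :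
    Nonempty (DivisorMonoidIsoOver (ModelFrobenioid.data d₁.Φ d₁.B d₁.divB)
      (ModelFrobenioid.data d₂.Φ d₂.B d₂.divB) Ψ) :=
  nonempty_divisorMonoidIsoOver_padic d₁ d₂ (RelCosetCat.isOfFSMType P₀₁) (RelCosetCat.isOfFSMType P₀₂) Ψ

/-- **The typed compatibility clause `Thm49_compat` at `p`-adic Frobenioids over tempered bases, no hypothesis**:
`Ψ^Φ` over `Ψ` with `Div(Ψ φ) = Ψ^Φ_A(Div φ)` on pre-steps, compatible with THE `Ψ^Prime` of Thm. 4.2 (ii).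
[cite: MochizukiFrdI2008, Thm. 4.9 p.89] [cite: MochizukiFrdII2008, Ex 1.3 (iii) pp.11-12] -/
theorem exists_thm49_compat_padic_relCoset (Ψ : d₁.frobenioid ≌ d₂.frobenioid) :
    ∃ (E : DivisorMonoidIsoOver (ModelFrobenioid.data d₁.Φ d₁.B d₁.divB)
        (ModelFrobenioid.data d₂.Φ d₂.B d₂.divB) Ψ)
      (e : ∀ A : d₁.frobenioid,
        Primes ((ModelFrobenioid.data d₁.Φ d₁.B d₁.divB).Mon
            ((ModelFrobenioid.data d₁.Φ d₁.B d₁.divB).base.obj A)) ≃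
          Primes ((ModelFrobenioid.data d₂.Φ d₂.B d₂.divB).Mon
            ((ModelFrobenioid.data d₂.Φ d₂.B d₂.divB).base.obj (Ψ.functor.obj A)))),
      (∀ ⦃A B : d₁.frobenioid⦄ (φ : A ⟶ B), IsPreStep d₁.structureFunctor φ →
          E.iso A (Div d₁.structureFunctor φ) = Div d₂.structureFunctor (Ψ.functor.map φ)) ∧
      (ModelFrobenioid.data d₁.Φ d₁.B d₁.divB).Thm49_compat (ModelFrobenioid.data d₂.Φ d₂.B d₂.divB) Ψ E e :=
  exists_thm49_compat_padic d₁ d₂ (RelCosetCat.isOfFSMType P₀₁) (RelCosetCat.isOfFSMType P₀₂) Ψ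

end Tempered

end PadicFrd

end Literature.AlgebraicGeometry.Frobenioids

end
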